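import Summits.Schanuel.Schanuel.Theorems.ZilberEacBranchOneDirection
import Summits.Schanuel.Schanuel.Theorems.ZilberEacCurveGraphFibreCase
import Summits.Schanuel.Schanuel.Theorems.ZilberEacEllipticBaseExample
import Literature.ModelTheory.Zilber.EACCyclicCoverBases
import HarnessLib

/-!
# Arbitrary base branches, XX: the two-parameter family `x₁^k = x₀^M + 1` — constant fibres are
# in Mantova–Masser's case AND dense, in every growth regime, for all `(k, M)` off one residue class

HONEST FRAMING.  Cell `pub-schanuel` (Zilber's Exponential-Algebraic Closedness, case ladder;
host summit Schanuel), seat 2, gen 28.  The plane curve `C_{k,M} : x₁^k = x₀^M + 1` (`k, M ≥ 1`;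
irreducible — Eisenstein at a simple root of `s^M + 1`) has at `x₀ = ∞` the branch `x₀ = s^{-k}`,
`x₁ = (1 + s^{kM})^{1/k}s^{-M}`: label order `k`, second order `M`, direction `Φ(0) = 1`.  By file
XIX ONE `k`-th root `z` of `2πi` with `Re(z^M) ≠ 0` suffices for density, and such a root EXISTS
unless `k ∣ 2M` with `2M/k ≡ 2 (mod 4)` (**`exists_direction_powerCurve`**: if `k ∤ 2M`, file XIX's
three-directions lemma; if `2M = ke`, then `(z^M)² = (2πi)^e`, and a purely imaginary `z^M` forces
`i^e < 0`, i.e. `e ≡ 2 (mod 4)`).  Hence **`unprojectedDensityQuestion_powerCurve_constFibre`**: for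
`k ≥ 2`, `M ≥ 1`, `¬(k ∣ 2M ∧ 2M/k ≡ 2 mod 4)` and every `θ ≠ 0`, the constant-fibre cylinder
`{x₁^k − x₀^M − 1 = 0, y₀ = θ} ⊆ ℂ² × ℂ²` is in Mantova–Masser's case (dim-π-S-1-free; points
`(0,1)`, `(0,ω)`, `(ζ,0)`) AND has Zariski-dense exponential points — a two-parameter family of
decided instances in ALL growth regimes with NO direction hypothesis: SLOW (`M < k`: `(2,1)`,
`(3,1)`, `(3,2)`, `(4,1)`, `(4,3)`, `(5,·)`), EQUAL-TYPE and FAST (`(2,3)` = the Weierstrass cubic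
`x₁² = x₀³ + 1`, `(2,4)`, `(3,4)`, `(3,6)`, `(4,2)`, `(4,6)`, …).  The excluded class
(`(1, odd)`, `(2, 2 mod 4)` — e.g. the hyperbola `x₁² = x₀² + 1` with rational asymptotes —,
`(3,3)`, `(4,4)`, …) is exactly where the leading term of the phase is purely imaginary and the
method is silent (it contains rescaled non-dense cylinders, `x₁ = x₀²/(2πi)`, gen 22).  File XVIII
is the instance `(3, 2)`.  Decided instances of an OPEN question (Mantova–Masser, PLMS 2024 §1
p. 5); EC(3,2) OPEN; NOT Schanuel's conjecture (neither used nor implied); EAC ⇏ SC.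
-/

noncomputable section

open Filter Topology Set Complex MvPolynomial
open Literature.NumberTheory.Transcendental Literature.ModelTheory.Zilber
open Literature.ModelTheory.ExponentialFields

set_option linter.dupNamespace false

namespace Summit.Schanuel.Schanuel.Theorems

/-! ## Part A. `x₁^k − x₀^M − 1` is irreducible (Eisenstein at a simple root of `s^M + 1`) -/

/-- `(X − ζ)² ∤ X^M + 1` in `ℂ[X]` (`M ≥ 1`): `X^M + 1` is separable. [folklore] -/
theorem X_sub_C_sq_not_dvd_X_pow_add_one {M : ℕ} (hM : 1 ≤ M) (ζ : ℂ) :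
    ¬ (Polynomial.X - Polynomial.C ζ) ^ 2 ∣ (Polynomial.X ^ M + 1 : Polynomial ℂ) := by
  intro h
  have hsep : Polynomial.Separable (Polynomial.X ^ M - Polynomial.C (-1 : ℂ)) :=
    Polynomial.separable_X_pow_sub_C (-1 : ℂ) (by exact_mod_cast (show M ≠ 0 by omega))
      (by norm_num)
  have h' : (Polynomial.X - Polynomial.C ζ) * (Polynomial.X - Polynomial.C ζ) ∣
      Polynomial.X ^ M - Polynomial.C (-1 : ℂ) := by
    rw [← sq, Polynomial.C_neg, Polynomial.C_1, sub_neg_eq_add]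
    exact h
  exact Polynomial.not_isUnit_X_sub_C ζ (hsep.squarefree _ h')

/-- The relation `t^k − (s^M + 1)` is irreducible in `ℂ[s][t]` (`k, M ≥ 1`): Eisenstein at
`(s − ζ)`, `ζ^M = −1` — the cyclic-cover lemma `irreducible_X_pow_sub_C` of
`Literature.ModelTheory.Zilber.EACCyclicCoverBases`. [folklore] -/
theorem irreducible_powerCurve_row {k M : ℕ} (hk : 1 ≤ k) (hM : 1 ≤ M) :
    Irreducible (Polynomial.X ^ k + Polynomial.C (-(Polynomial.X ^ M + 1) : Polynomial ℂ)) := by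
  obtain ⟨ζ, hζ⟩ := IsAlgClosed.exists_pow_nat_eq (-1 : ℂ) (by omega : 0 < M)
  have hdvd : (Polynomial.X - Polynomial.C ζ) ∣ (Polynomial.X ^ M + 1 : Polynomial ℂ) := by
    rw [Polynomial.dvd_iff_isRoot]
    simp [Polynomial.IsRoot, hζ]
  have h := irreducible_X_pow_sub_C (by omega : 0 < k) (Polynomial.prime_X_sub_C ζ) hdvd
    (X_sub_C_sq_not_dvd_X_pow_add_one hM ζ)
  rwa [Polynomial.C_neg, ← sub_eq_add_neg]

/-- Evaluation of `x₁^k − x₀^M − 1`. -/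
theorem eval_powerCurveMv (k M : ℕ) (x : Fin 2 → ℂ) :
    MvPolynomial.eval x (X 1 ^ k - X 0 ^ M - 1 : MvPolynomial (Fin 2) ℂ) =
      x 1 ^ k - x 0 ^ M - 1 := by
  simp

/-- `x₁^k − x₀^M − 1` and its rows. -/
theorem eval_powerCurveMv_rows (k M : ℕ) (x y : ℂ) :
    MvPolynomial.eval ![x, y] (X 1 ^ k - X 0 ^ M - 1 : MvPolynomial (Fin 2) ℂ) =
      ((Polynomial.X ^ k + Polynomial.C (-(Polynomial.X ^ M + 1) : Polynomial ℂ)).map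
        (Polynomial.evalRingHom x)).eval y := by
  rw [eval_powerCurveMv]
  simp
  ring

/-- `x₁^k − x₀^M − 1` is irreducible in `ℂ[x₀, x₁]` (`k, M ≥ 1`). [folklore] -/
theorem irreducible_powerCurveMv {k M : ℕ} (hk : 1 ≤ k) (hM : 1 ≤ M) :
    Irreducible (X 1 ^ k - X 0 ^ M - 1 : MvPolynomial (Fin 2) ℂ) :=
  (irreducible_rows_iff (eval_powerCurveMv_rows k M)).2 (irreducible_powerCurve_row hk hM)

/-! ## Part B. The branch at infinity and density -/

/-- The analytic `k`-th root: `q(v) = (1 + v)^{1/k}` (principal), `q(0) = 1`, `q(v)^k = 1 + v`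
near `0` (`k ≥ 1`). [folklore] -/
theorem kthRoot_branch_facts {k : ℕ} (hk : 1 ≤ k) :
    ∃ q : ℂ → ℂ, AnalyticAt ℂ q 0 ∧ q 0 = 1 ∧ ∀ᶠ v in 𝓝 (0 : ℂ), q v ^ k = 1 + v := by
  have hkC : (k : ℂ) ≠ 0 := Nat.cast_ne_zero.2 (by omega)
  set q : ℂ → ℂ := fun v => Complex.exp ((1 / (k : ℂ)) * Complex.log (1 + v)) with hq
  have h1v : AnalyticAt ℂ (fun v : ℂ => 1 + v) 0 := analyticAt_const.add analyticAt_id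
  have hqan : AnalyticAt ℂ q 0 :=
    (analyticAt_const.mul (h1v.clog (by simp [Complex.one_mem_slitPlane]))).cexp
  have hq0 : q 0 = 1 := by simp [hq]
  have hsmall : ∀ᶠ v in 𝓝 (0 : ℂ), ‖v‖ < 1 := by
    have := Metric.ball_mem_nhds (0 : ℂ) one_pos
    filter_upwards [this] with v hv
    rwa [Metric.mem_ball, dist_zero_right] at hv
  refine ⟨q, hqan, hq0, ?_⟩
  filter_upwards [hsmall] with v hv
  have hne0 : 1 + v ≠ 0 := Complex.slitPlane_ne_zero (Complex.mem_slitPlane_of_norm_lt_one hv)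
  rw [hq]
  simp only
  rw [← Complex.exp_nat_mul, ← mul_assoc, show ((k : ℕ) : ℂ) * (1 / (k : ℂ)) = 1 by field_simp,
    one_mul]
  exact Complex.exp_log hne0

/-- If `w² = (2πi)^e` with `e ≢ 2 (mod 4)` then `Re w ≠ 0`: a purely imaginary `w` has
`w² = −‖w‖² ≤ 0`, while `(2πi)^e = (2π)^e·i^{e mod 4}` is a non-positive real only for
`e ≡ 2 (mod 4)`. [folklore] -/
theorem re_ne_zero_of_sq_eq_two_pi_I_pow {w : ℂ} {e : ℕ} (hw : w ^ 2 = (2 * Real.pi * I) ^ e)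
    (he : e % 4 ≠ 2) : w.re ≠ 0 := by
  intro hre
  have hpos : (0 : ℝ) < (2 * Real.pi) ^ e := by positivity
  have hsplit : (2 * Real.pi * I : ℂ) ^ e = (((2 * Real.pi) ^ e : ℝ) : ℂ) * I ^ (e % 4) := by
    rw [← Complex.I_pow_eq_pow_mod, mul_pow]
    push_cast
    ring
  -- `(2π)^e · i^(e mod 4) = −‖w‖²`
  have key : (((2 * Real.pi) ^ e : ℝ) : ℂ) * I ^ (e % 4) = -(((‖w‖ ^ 2 : ℝ)) : ℂ) := by
    rw [← hsplit, ← hw]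
    exact sq_eq_neg_norm_sq_of_re_eq_zero hre
  have hI3 : I ^ 3 = -I := by
    rw [pow_succ, Complex.I_sq]
    ring
  have hcases : e % 4 = 0 ∨ e % 4 = 1 ∨ e % 4 = 2 ∨ e % 4 = 3 := by omega
  rcases hcases with h0 | h1 | h2 | h3
  · rw [h0, pow_zero, mul_one, ← Complex.ofReal_neg] at key
    have := Complex.ofReal_injective key
    nlinarith [sq_nonneg ‖w‖]
  · rw [h1, pow_one] at key
    have := congrArg Complex.im key
    rw [Complex.im_ofReal_mul, Complex.I_im, mul_one, Complex.neg_im, Complex.ofReal_im,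
      neg_zero] at this
    exact hpos.ne' this
  · exact he h2
  · rw [h3, hI3, mul_neg, neg_inj] at key
    have := congrArg Complex.im key
    rw [Complex.im_ofReal_mul, Complex.I_im, mul_one, Complex.ofReal_im] at this
    exact hpos.ne' this

/-- **Directions for `x₁^k = x₀^M + 1`** (`Φ(0) = 1`): a `k`-th root `z` of `2πi` with
`Re(z^M) ≠ 0` exists unless `k ∣ 2M` with `2M/k ≡ 2 (mod 4)` — by file XIX's three-directions
lemma when `k ∤ 2M`, and by `(z^M)² = (2πi)^{2M/k}` otherwise. [folklore] -/
theorem exists_direction_powerCurve {k M : ℕ} (hk : 1 ≤ k)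
    (hres : ¬ (k ∣ 2 * M ∧ (2 * M / k) % 4 = 2)) :
    ∃ z : ℂ, z ^ k = 2 * Real.pi * I ∧ (z ^ M).re ≠ 0 := by
  by_cases hkM : k ∣ 2 * M
  · obtain ⟨e, he⟩ := hkM
    have he4 : e % 4 ≠ 2 := by
      intro h4
      apply hres
      refine ⟨⟨e, he⟩, ?_⟩
      rw [he, Nat.mul_div_cancel_left _ (by omega)]
      exact h4
    obtain ⟨z, hz⟩ := IsAlgClosed.exists_pow_nat_eq (2 * Real.pi * I : ℂ) (by omega : 0 < k)
    refine ⟨z, hz, re_ne_zero_of_sq_eq_two_pi_I_pow ?_ he4⟩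
    rw [← pow_mul, Nat.mul_comm M 2, he, pow_mul, hz]
  · obtain ⟨z, hz, hre⟩ := exists_direction_of_not_dvd hk hkM (by norm_num : (1 : ℂ) ≠ 0) (M := M)
    exact ⟨z, hz, by simpa using hre⟩

/-- **Constant fibres over `x₁^k = x₀^M + 1` are dense unless `k ∣ 2M ∧ 2M/k ≡ 2 (mod 4)`**
(`k, M ≥ 1`, `θ ≠ 0`): the branch at infinity `x₀ = s^{-k}`, `x₁ = (1 + s^{kM})^{1/k}s^{-M}` has
direction `1`, a good `k`-th root of `2πi` exists (`exists_direction_powerCurve`), and ONE good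
direction suffices (file XIX).
[cite: MantovaMasser2023, §1 Further remarks, p. 5 (the question, open in general)] (new) -/
theorem unprojectedDense_powerCurve_constFibre {k M : ℕ} (hk : 1 ≤ k) (hM : 1 ≤ M)
    (hres : ¬ (k ∣ 2 * M ∧ (2 * M / k) % 4 = 2)) {θ : ℂ} (hθ : θ ≠ 0) :
    UnprojectedDense {w : Fin 2 ⊕ Fin 2 → ℂ |
      MvPolynomial.eval ![w (Sum.inl 0), w (Sum.inl 1)]
          (X 1 ^ k - X 0 ^ M - 1 : MvPolynomial (Fin 2) ℂ) = 0 ∧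
      w (Sum.inr 0) = MvPolynomial.eval ![w (Sum.inl 0), w (Sum.inl 1)]
        (MvPolynomial.C θ : MvPolynomial (Fin 2) ℂ)} := by
  have hS := isIrreducibleClosed_curveGraphFibre (MvPolynomial.C θ : MvPolynomial (Fin 2) ℂ)
    (irreducible_powerCurveMv hk hM)
  have hdim := zariskiDim_curveGraphFibre (MvPolynomial.C θ : MvPolynomial (Fin 2) ℂ)
    (irreducible_powerCurveMv hk hM)
  obtain ⟨q, hqan, hq0, hqk⟩ := kthRoot_branch_facts hk
  have hN0 : k * M ≠ 0 := Nat.mul_ne_zero (by omega) (by omega)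
  -- `x₀ = s^{-k}`, `x₁ = q(s^{kM}) s^{-M}`, `y₀ = θ`
  set Φ : ℂ → ℂ := fun s => q (s ^ (k * M)) with hΦ
  have hsN : AnalyticAt ℂ (fun s : ℂ => s ^ (k * M)) 0 := analyticAt_id.pow (k * M)
  have hΦan : AnalyticAt ℂ Φ 0 := hqan.comp_of_eq hsN (by simp [zero_pow hN0])
  have hΦ0 : Φ 0 = 1 := by simp [hΦ, zero_pow hN0, hq0]
  have hψan : AnalyticAt ℂ (fun _ : ℂ => θ) 0 := analyticAt_const
  have hqk' : ∀ᶠ s in 𝓝 (0 : ℂ), q (s ^ (k * M)) ^ k = 1 + s ^ (k * M) := by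
    have h : Tendsto (fun s : ℂ => s ^ (k * M)) (𝓝 0) (𝓝 0) := by
      have := (continuous_pow (k * M)).tendsto (0 : ℂ)
      rwa [zero_pow hN0] at this
    exact h.eventually hqk
  have hgerm : ∀ᶠ s in 𝓝[≠] (0 : ℂ),
      (Sum.elim ![(s ^ k)⁻¹, Φ s * (s ^ M)⁻¹]
          ![(fun _ : ℂ => θ) s, Complex.exp (Φ s * (s ^ M)⁻¹)] : Fin 2 ⊕ Fin 2 → ℂ) ∈
        {w : Fin 2 ⊕ Fin 2 → ℂ |
          MvPolynomial.eval ![w (Sum.inl 0), w (Sum.inl 1)]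
              (X 1 ^ k - X 0 ^ M - 1 : MvPolynomial (Fin 2) ℂ) = 0 ∧
          w (Sum.inr 0) = MvPolynomial.eval ![w (Sum.inl 0), w (Sum.inl 1)]
            (MvPolynomial.C θ : MvPolynomial (Fin 2) ℂ)} := by
    filter_upwards [self_mem_nhdsWithin, nhdsWithin_le_nhds hqk'] with s (hs : s ≠ 0) hqs
    refine ⟨?_, ?_⟩
    · simp only [Sum.elim_inl, Matrix.cons_val_zero, Matrix.cons_val_one]
      rw [eval_powerCurveMv]
      simp only [Matrix.cons_val_zero, Matrix.cons_val_one, hΦ]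
      rw [mul_pow, hqs, inv_pow, inv_pow, ← pow_mul, ← pow_mul, Nat.mul_comm M k]
      have hskM : s ^ (k * M) ≠ 0 := pow_ne_zero _ hs
      field_simp
      ring
    · simp only [Sum.elim_inr, Matrix.cons_val_zero, MvPolynomial.eval_C]
  obtain ⟨z, hz, hzre⟩ := exists_direction_powerCurve hk hres (M := M)
  exact unprojectedDense_branch_growth_of_exists_direction hS (le_of_eq hdim) hk hM hψan hθ rfl
    hΦan ⟨z, hz, by rw [hΦ0, one_mul]; exact hzre⟩ hgerm

/-! ## Part C. The case certificate, and case ∧ dense -/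

/-- **The constant-fibre cylinder over `x₁^k = x₀^M + 1` is in Mantova–Masser's case**
(`k ≥ 2`, `M ≥ 1`, `θ ≠ 0`): the points `(0, 1)`, `(0, ω)` (`ω = e^{2πi/k}`), `(ζ, 0)` (`ζ^M = −1`)
of the curve are not collinear. (new) -/
theorem mmCase_powerCurve_constFibre {k M : ℕ} (hk : 2 ≤ k) (hM : 1 ≤ M) {θ : ℂ} (hθ : θ ≠ 0) :
    MMCaseDimPiOneFree {w : Fin 2 ⊕ Fin 2 → ℂ |
      MvPolynomial.eval ![w (Sum.inl 0), w (Sum.inl 1)]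
          (X 1 ^ k - X 0 ^ M - 1 : MvPolynomial (Fin 2) ℂ) = 0 ∧
      w (Sum.inr 0) = MvPolynomial.eval ![w (Sum.inl 0), w (Sum.inl 1)]
        (MvPolynomial.C θ : MvPolynomial (Fin 2) ℂ)} := by
  have hM0 : M ≠ 0 := by omega
  have hk0 : k ≠ 0 := by omega
  refine mmCase_curveGraphFibre (irreducible_powerCurveMv (by omega) hM) ?_ ?_
  · exact ⟨![0, 1], by rw [eval_powerCurveMv]; simp [zero_pow hM0],
      by rw [MvPolynomial.eval_C]; exact hθ⟩
  · intro m hm c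
    have hω := Complex.isPrimitiveRoot_exp k hk0
    set ω : ℂ := Complex.exp (2 * Real.pi * I / k) with hωdef
    have hωk : ω ^ k = 1 := hω.pow_eq_one
    have hω1 : ω ≠ 1 := hω.ne_one (by omega)
    obtain ⟨ζ, hζ⟩ := IsAlgClosed.exists_pow_nat_eq (-1 : ℂ) (by omega : 0 < M)
    have hζ0 : ζ ≠ 0 := by
      rintro rfl
      rw [zero_pow hM0] at hζ
      norm_num at hζ
    by_cases h1 : (m 0 : ℂ) * 0 + (m 1 : ℂ) * 1 ≠ c
    · exact ⟨![0, 1], by rw [eval_powerCurveMv]; simp [zero_pow hM0], by simpa using h1⟩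
    by_cases h2 : (m 0 : ℂ) * 0 + (m 1 : ℂ) * ω ≠ c
    · exact ⟨![0, ω], by rw [eval_powerCurveMv]; simp [hωk, zero_pow hM0], by simpa using h2⟩
    push Not at h1 h2
    refine ⟨![ζ, 0], by rw [eval_powerCurveMv]; simp [hζ, zero_pow hk0], ?_⟩
    simp only [Matrix.cons_val_zero, Matrix.cons_val_one, mul_zero, add_zero]
    intro h3
    have hm1 : (m 1 : ℂ) = 0 := by
      have h : (m 1 : ℂ) * (1 - ω) = 0 := by linear_combination h1 - h2
      rcases mul_eq_zero.1 h with h | h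
      · exact h
      · exact absurd (by linear_combination -h) hω1
    have hc : c = 0 := by rw [← h1, hm1]; simp
    have hm0 : (m 0 : ℂ) = 0 := by
      rw [hc] at h3
      rcases mul_eq_zero.1 h3 with h | h
      · exact h
      · exact absurd h hζ0
    apply hm
    funext i
    fin_cases i
    · exact_mod_cast hm0
    · exact_mod_cast hm1

/-- **Mantova–Masser's question for constant fibres over `x₁^k = x₀^M + 1`: case ∧ dense**
for all `k ≥ 2`, `M ≥ 1` off the residue class `k ∣ 2M ∧ 2M/k ≡ 2 (mod 4)`, and all `θ ≠ 0`.
[cite: MantovaMasser2023, §1 Further remarks, p. 5 (the question, open in general)] (new) -/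
theorem unprojectedDensityQuestion_powerCurve_constFibre {k M : ℕ} (hk : 2 ≤ k) (hM : 1 ≤ M)
    (hres : ¬ (k ∣ 2 * M ∧ (2 * M / k) % 4 = 2)) {θ : ℂ} (hθ : θ ≠ 0) :
    MMCaseDimPiOneFree {w : Fin 2 ⊕ Fin 2 → ℂ |
        MvPolynomial.eval ![w (Sum.inl 0), w (Sum.inl 1)]
            (X 1 ^ k - X 0 ^ M - 1 : MvPolynomial (Fin 2) ℂ) = 0 ∧
        w (Sum.inr 0) = MvPolynomial.eval ![w (Sum.inl 0), w (Sum.inl 1)]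
          (MvPolynomial.C θ : MvPolynomial (Fin 2) ℂ)} ∧
      UnprojectedDense {w : Fin 2 ⊕ Fin 2 → ℂ |
        MvPolynomial.eval ![w (Sum.inl 0), w (Sum.inl 1)]
            (X 1 ^ k - X 0 ^ M - 1 : MvPolynomial (Fin 2) ℂ) = 0 ∧
        w (Sum.inr 0) = MvPolynomial.eval ![w (Sum.inl 0), w (Sum.inl 1)]
          (MvPolynomial.C θ : MvPolynomial (Fin 2) ℂ)} :=
  ⟨mmCase_powerCurve_constFibre hk hM hθ,
    unprojectedDense_powerCurve_constFibre (by omega) hM hres hθ⟩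

/-- **Plain coordinates**: `{x₁^k − x₀^M − 1 = 0, y₀ = θ}` (`k ≥ 2`, `M ≥ 1`,
`¬(k ∣ 2M ∧ 2M/k ≡ 2 mod 4)`, `θ ≠ 0`) is in the case AND dense.
[cite: MantovaMasser2023, §1 Further remarks, p. 5 (the question, open in general)] (new) -/
theorem unprojectedDensityQuestion_powerCurve_constFibre' {k M : ℕ} (hk : 2 ≤ k) (hM : 1 ≤ M)
    (hres : ¬ (k ∣ 2 * M ∧ (2 * M / k) % 4 = 2)) {θ : ℂ} (hθ : θ ≠ 0) :
    MMCaseDimPiOneFree {w : Fin 2 ⊕ Fin 2 → ℂ |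
        w (Sum.inl 1) ^ k - w (Sum.inl 0) ^ M - 1 = 0 ∧ w (Sum.inr 0) = θ} ∧
      UnprojectedDense {w : Fin 2 ⊕ Fin 2 → ℂ |
        w (Sum.inl 1) ^ k - w (Sum.inl 0) ^ M - 1 = 0 ∧ w (Sum.inr 0) = θ} := by
  have e : {w : Fin 2 ⊕ Fin 2 → ℂ |
        MvPolynomial.eval ![w (Sum.inl 0), w (Sum.inl 1)]
            (X 1 ^ k - X 0 ^ M - 1 : MvPolynomial (Fin 2) ℂ) = 0 ∧
        w (Sum.inr 0) = MvPolynomial.eval ![w (Sum.inl 0), w (Sum.inl 1)]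
          (MvPolynomial.C θ : MvPolynomial (Fin 2) ℂ)} =
      {w : Fin 2 ⊕ Fin 2 → ℂ |
        w (Sum.inl 1) ^ k - w (Sum.inl 0) ^ M - 1 = 0 ∧ w (Sum.inr 0) = θ} := by
    ext w
    simp only [Set.mem_setOf_eq, eval_powerCurveMv, MvPolynomial.eval_C, Matrix.cons_val_zero,
      Matrix.cons_val_one]
  have h := unprojectedDensityQuestion_powerCurve_constFibre hk hM hres hθ
  rw [e] at h
  exact h

/-- **`k ∤ 2M` version** (`k ≥ 1`; then `k ≥ 3` automatically): `{x₁^k − x₀^M − 1 = 0, y₀ = θ}`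
is in the case AND dense. [cite: MantovaMasser2023, §1 Further remarks, p. 5 (the question, open in
general)] (new) -/
theorem unprojectedDensityQuestion_powerCurve_constFibre_of_not_dvd {k M : ℕ} (hk : 1 ≤ k)
    (hM : 1 ≤ M) (hkM : ¬ k ∣ 2 * M) {θ : ℂ} (hθ : θ ≠ 0) :
    MMCaseDimPiOneFree {w : Fin 2 ⊕ Fin 2 → ℂ |
        w (Sum.inl 1) ^ k - w (Sum.inl 0) ^ M - 1 = 0 ∧ w (Sum.inr 0) = θ} ∧
      UnprojectedDense {w : Fin 2 ⊕ Fin 2 → ℂ |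
        w (Sum.inl 1) ^ k - w (Sum.inl 0) ^ M - 1 = 0 ∧ w (Sum.inr 0) = θ} := by
  have hk2 : 2 ≤ k := by
    by_contra h
    have h1 : k = 1 := by omega
    subst h1
    exact hkM (one_dvd _)
  exact unprojectedDensityQuestion_powerCurve_constFibre' hk2 hM (fun h => hkM h.1) hθ

/-- **Examples in all regimes**, for the record (`θ ≠ 0`): the Weierstrass cubic
`{x₁² = x₀³ + 1, y₀ = θ}` (`(k, M) = (2, 3)`, fast), the slow `{x₁³ = x₀ + 1, y₀ = θ}` (`(3, 1)`), and
the fast ramified `{x₁³ = x₀⁴ + 1, y₀ = θ}` (`(3, 4)`) are in the case AND dense.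
[cite: MantovaMasser2023, §1 Further remarks, p. 5 (the question, open in general)] (new) -/
theorem unprojectedDensityQuestion_powerCurve_examples {θ : ℂ} (hθ : θ ≠ 0) :
    (MMCaseDimPiOneFree {w : Fin 2 ⊕ Fin 2 → ℂ |
        w (Sum.inl 1) ^ 2 - w (Sum.inl 0) ^ 3 - 1 = 0 ∧ w (Sum.inr 0) = θ} ∧
      UnprojectedDense {w : Fin 2 ⊕ Fin 2 → ℂ |
        w (Sum.inl 1) ^ 2 - w (Sum.inl 0) ^ 3 - 1 = 0 ∧ w (Sum.inr 0) = θ}) ∧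
    (MMCaseDimPiOneFree {w : Fin 2 ⊕ Fin 2 → ℂ |
        w (Sum.inl 1) ^ 3 - w (Sum.inl 0) ^ 1 - 1 = 0 ∧ w (Sum.inr 0) = θ} ∧
      UnprojectedDense {w : Fin 2 ⊕ Fin 2 → ℂ |
        w (Sum.inl 1) ^ 3 - w (Sum.inl 0) ^ 1 - 1 = 0 ∧ w (Sum.inr 0) = θ}) ∧
    (MMCaseDimPiOneFree {w : Fin 2 ⊕ Fin 2 → ℂ |
        w (Sum.inl 1) ^ 3 - w (Sum.inl 0) ^ 4 - 1 = 0 ∧ w (Sum.inr 0) = θ} ∧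
      UnprojectedDense {w : Fin 2 ⊕ Fin 2 → ℂ |
        w (Sum.inl 1) ^ 3 - w (Sum.inl 0) ^ 4 - 1 = 0 ∧ w (Sum.inr 0) = θ}) :=
  ⟨unprojectedDensityQuestion_powerCurve_constFibre' (le_refl 2) (by norm_num) (by decide) hθ,
    unprojectedDensityQuestion_powerCurve_constFibre' (by norm_num) (by norm_num) (by decide) hθ,
    unprojectedDensityQuestion_powerCurve_constFibre' (by norm_num) (by norm_num) (by decide) hθ⟩

end Summit.Schanuel.Schanuel.Theorems

end
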